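import Summits.CriticalPhenomena.CardyFormulaZ2.Theses.CardyRotToConf
import HarnessLib

/-!
# Birth skeleton (BC3) for the crux `CardyRotToConf.CardyRotToConfLimitFamily`
(item `stmt-CriticalPhenomena-11301`, rank 4 of route `route-CriticalPhenomena-CardyRotToConf`,
sub-problem `CardyFormulaZ2`; skeleton registrar `planner-skel-stmt-CriticalPhenomena-11301-0`,
2026-08-17; tree path `Summits/CriticalPhenomena/CardyFormulaZ2/Cruxes/CardyRotToConfLimitFamily/Lines/birth.lean`).

The crux r4: ASSUMING (i) rotation invariance of the critical `ℤ²` interface-loop ensemble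
(= route item `CardyRotToConfLoopRotation`, DKKMO arXiv:2012.11672 v2 Thm 1.2 at `q = 1`),
(ii) every Dobrushin domain is `ℤ²`-discretisable (= route item `CardyRotToConfDiscretisationsExist`)
and (iii) r3 `CardyRotToConfR3ScaleInvariance` (the interface laws of EVERY discretisation family of
every Dobrushin domain converge in law), there is ONE chordal family `P` with
`IsLocalMarkovChordalFamily P` (chordal, similarity covariant, domain Markov, local, target
independent), `P`-a.s. tracing no boundary arc, with `bondInterfaceIn D (E δ) → P D` in law for every
`D` and every `IsDiscretisation` family `E`.

## The line (the route's own TWO-LAYER PLAN for this node, cut by mechanism)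

Write `IsLimit P` for "`P` is THE `ℤ²` interface limit family": for every Dobrushin domain `D` and
every `IsDiscretisation D E`, `TendstoLaw (bondInterfaceIn D (E ·)) P_{1/2} id (P D)` (spelled out in
full in every signature below, so that a `--supports` proof can restate a stub verbatim with only the
route file imported).

* PROVED HERE (sorry-free, `exists_interfaceLimit`): **canonicity** — (ii) + (iii) ⇒ `∃ P, IsLimit P`.
  The limit of r3 does not depend on the discretisation family: two discretisation families of the
  same domain INTERLEAVED along the even / odd reciprocal meshes form again a discretisation family
  (`isDiscretisation_interleave`), so r3 applied to the interleaved family and uniqueness of limits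
  along the two mesh sequences identify the two limits functional by functional. This is the piece
  "canonicity (independence of E) from r3" of the route's plan; it is no longer a stub.
* `stub_chordal` (M) — `IsLimit P ⇒ P.IsChordal`: each `P D` is a probability law carried by curves
  in `D̄` from `a` to `b` (mass one from `f ≡ 1`; support and end points by the portmanteau theorem on
  closed sets from `(E δ).arcA/arcB → (ab)/(ba)`, `zdABEdges → {a,b}` and `Ω_δ ⊆ D`).
* `stub_similarityCovariance` (XL; LOAD-BEARING, uses (i)) — `(i) ⇒ IsLimit P ⇒ P.IsSimilarityCovariant`:
  translation covariance (O(δ) boundary-perturbation stability: half-plane 3-arm / one-arm bounds at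
  `a`, `b`), dilation covariance (exact lattice scaling `(λΩ)_δ = λ·Ω_{δ/λ}` + canonicity), rotation
  covariance (the loop-ensemble → exploration-interface transfer of DKKMO's coupling, Camia–Newman
  2006 §§4–5; this is where hypothesis (i) is consumed — cf. barrier `EmbeddingModulusUniqueness`:
  without (i) the statement is false for the stretched embeddings).
* `stub_domainMarkov` (XL) — `IsLimit P ⇒ P.IsDomainMarkov`: a Markov extension `Q D past` of the limit
  (exact exploration Markov property on the lattice; limit passage needs the interface limit in the
  RANDOM rough remaining domain, i.e. uniformity of r3 over Carathéodory-convergent Jordan domains —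
  refuter REVIEW.md on this item, `Negative.kernel_eq_of_jordan_remaining` of the r2 Disproof).
* `stub_locality` (L) — `IsLimit P ⇒ P.IsLocal ∧ P.IsTargetIndependent`: both are equalities of laws of
  curves STOPPED on a closed set; exact on the lattice (the exploration does not look beyond the
  stopping set), limit passage by a.s. continuity of `stopAt F` at the limit (hitting = crossing, RSW).
* `stub_nonTracing` (L) — `IsLimit P ⇒` no boundary-arc tracing, `P D`-a.s.: polychromatic half-plane
  3-arm bound in annuli centred on `∂D` (Camia–Newman 2006 §5), portmanteau on open sets.

`CardyRotToConfLimitFamily_of : stub sigs → CardyRotToConfLimitFamily` feeds the canonical `P` of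
`exists_interfaceLimit` to the five stubs and assembles `IsLocalMarkovChordalFamily P`; sorry-free,
concludes the crux BY NAME. Sorries: exactly the five `stub_*`.

Disproof used: none on file for THIS crux (`ledger crux ls stmt-CriticalPhenomena-11301`: no workfiles,
2026-08-17). Honoured from the sibling r2 record: the refuted pure upgrade
`Theorems.not_CardyRotToConfR2SymmetryUpgrade` (stmt-0698) is not assumed or restated by any stub (every
stub speaks of THE percolation limit family, pinned by `IsLimit`, never of an arbitrary admissible
family). Negatives index (11 entries, 2026-08-17): none equal or trivially equivalent to a stub.
-/

noncomputable section

open MeasureTheory Filter Set Topology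
open scoped ENNReal NNReal Classical
open Literature.Probability.RandomPlanarGeometry Literature.Probability.LatticeModels
  Literature.Probability.Percolation
open Summit.CriticalPhenomena.CardyFormulaZ2.Theses.CardyRotToConf
  (CardyRotToConfLoopRotation CardyRotToConfDiscretisationsExist CardyRotToConfR3ScaleInvariance
    CardyRotToConfLimitFamily)

namespace Summit.CriticalPhenomena.CardyFormulaZ2.Cruxes.CardyRotToConfLimitFamily.Birth

/-! ### Registered stubs (signatures written out in full) -/

/-- **S1 `stub_chordal` (M).** THE `ℤ²` interface limit family is chordal: every `P D` is a
probability law carried by curves in `closure D` from `a = D.pt 0` to `b = D.pt 1`. -/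
theorem stub_chordal :
    CardyRotToConfDiscretisationsExist → CardyRotToConfR3ScaleInvariance →
    ∀ P : ChordalFamily,
      (∀ (D : DobrushinDomain) (E : ℝ → DiscreteDobrushin), IsDiscretisation D E →
        TendstoLaw (Ωδ := fun _ => BondConfig (Site 2)) (fun δ => bondInterfaceIn D (E δ))
          (fun _ => bondPercolation (zdGraph 2) half) id (P D)) →
      P.IsChordal := by
  sorry

/-- **S2 `stub_similarityCovariance` (XL, load-bearing; consumes the DKKMO loop rotation invariance).**
Under (i) `CardyRotToConfLoopRotation`, THE `ℤ²` interface limit family is covariant under every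
similarity `z ↦ c z + w`, `c ≠ 0`. -/
theorem stub_similarityCovariance :
    CardyRotToConfLoopRotation → CardyRotToConfDiscretisationsExist →
    CardyRotToConfR3ScaleInvariance →
    ∀ P : ChordalFamily,
      (∀ (D : DobrushinDomain) (E : ℝ → DiscreteDobrushin), IsDiscretisation D E →
        TendstoLaw (Ωδ := fun _ => BondConfig (Site 2)) (fun δ => bondInterfaceIn D (E δ))
          (fun _ => bondPercolation (zdGraph 2) half) id (P D)) →
      P.IsSimilarityCovariant := by
  sorry

/-- **S3 `stub_domainMarkov` (XL).** THE `ℤ²` interface limit family has the domain Markov property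
(a Markov extension `Q` to explored configurations, `ChordalFamily.IsMarkovExtension`). -/
theorem stub_domainMarkov :
    CardyRotToConfDiscretisationsExist → CardyRotToConfR3ScaleInvariance →
    ∀ P : ChordalFamily,
      (∀ (D : DobrushinDomain) (E : ℝ → DiscreteDobrushin), IsDiscretisation D E →
        TendstoLaw (Ωδ := fun _ => BondConfig (Site 2)) (fun δ => bondInterfaceIn D (E δ))
          (fun _ => bondPercolation (zdGraph 2) half) id (P D)) →
      P.IsDomainMarkov := by
  sorry

/-- **S4 `stub_locality` (L).** THE `ℤ²` interface limit family is local in both printed forms: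
LSW's restriction form (`IsLocal`) and the splitting form / target independence. -/
theorem stub_locality :
    CardyRotToConfDiscretisationsExist → CardyRotToConfR3ScaleInvariance →
    ∀ P : ChordalFamily,
      (∀ (D : DobrushinDomain) (E : ℝ → DiscreteDobrushin), IsDiscretisation D E →
        TendstoLaw (Ωδ := fun _ => BondConfig (Site 2)) (fun δ => bondInterfaceIn D (E δ))
          (fun _ => bondPercolation (zdGraph 2) half) id (P D)) →
      P.IsLocal ∧ P.IsTargetIndependent := by
  sorry

/-- **S5 `stub_nonTracing` (L).** THE `ℤ²` interface limit family traces no boundary arc: `P D`-a.s.,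
every sub-arc of the curve contained in `∂D` is a point. -/
theorem stub_nonTracing :
    CardyRotToConfDiscretisationsExist → CardyRotToConfR3ScaleInvariance →
    ∀ P : ChordalFamily,
      (∀ (D : DobrushinDomain) (E : ℝ → DiscreteDobrushin), IsDiscretisation D E →
        TendstoLaw (Ωδ := fun _ => BondConfig (Site 2)) (fun δ => bondInterfaceIn D (E δ))
          (fun _ => bondPercolation (zdGraph 2) half) id (P D)) →
      ∀ D : DobrushinDomain, ∀ᵐ γ ∂(P D), ∀ c : Curve ℂ, CurveClass.mk c = γ →
        ∀ s t : unitInterval, s < t → c '' Set.Icc s t ⊆ frontier D.carrier →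
          (c '' Set.Icc s t).Subsingleton := by
  sorry

/-! ### Name-keyed aliases of the five statements

The hypotheses of the composition: the skeleton audit admits a hypothesis only if its head constant is
a registered obligation or is named like a declared stub. Each alias repeats the stub's signature
verbatim (generated from one source). -/
namespace Registered

/-- Alias of the statement of `stub_chordal` (chordality of THE ℤ² interface limit family), keyed by the registered stub name. -/
abbrev stub_chordal : Prop :=
    CardyRotToConfDiscretisationsExist → CardyRotToConfR3ScaleInvariance →
    ∀ P : ChordalFamily,
      (∀ (D : DobrushinDomain) (E : ℝ → DiscreteDobrushin), IsDiscretisation D E →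
        TendstoLaw (Ωδ := fun _ => BondConfig (Site 2)) (fun δ => bondInterfaceIn D (E δ))
          (fun _ => bondPercolation (zdGraph 2) half) id (P D)) →
      P.IsChordal

/-- Alias of the statement of `stub_similarityCovariance` (similarity covariance of THE ℤ² interface limit family, from (i)), keyed by the registered stub name. -/
abbrev stub_similarityCovariance : Prop :=
    CardyRotToConfLoopRotation → CardyRotToConfDiscretisationsExist →
    CardyRotToConfR3ScaleInvariance →
    ∀ P : ChordalFamily,
      (∀ (D : DobrushinDomain) (E : ℝ → DiscreteDobrushin), IsDiscretisation D E →
        TendstoLaw (Ωδ := fun _ => BondConfig (Site 2)) (fun δ => bondInterfaceIn D (E δ))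
          (fun _ => bondPercolation (zdGraph 2) half) id (P D)) →
      P.IsSimilarityCovariant

/-- Alias of the statement of `stub_domainMarkov` (domain Markov property of THE ℤ² interface limit family), keyed by the registered stub name. -/
abbrev stub_domainMarkov : Prop :=
    CardyRotToConfDiscretisationsExist → CardyRotToConfR3ScaleInvariance →
    ∀ P : ChordalFamily,
      (∀ (D : DobrushinDomain) (E : ℝ → DiscreteDobrushin), IsDiscretisation D E →
        TendstoLaw (Ωδ := fun _ => BondConfig (Site 2)) (fun δ => bondInterfaceIn D (E δ))
          (fun _ => bondPercolation (zdGraph 2) half) id (P D)) →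
      P.IsDomainMarkov

/-- Alias of the statement of `stub_locality` (locality (restriction form) and target independence of THE ℤ² interface limit family), keyed by the registered stub name. -/
abbrev stub_locality : Prop :=
    CardyRotToConfDiscretisationsExist → CardyRotToConfR3ScaleInvariance →
    ∀ P : ChordalFamily,
      (∀ (D : DobrushinDomain) (E : ℝ → DiscreteDobrushin), IsDiscretisation D E →
        TendstoLaw (Ωδ := fun _ => BondConfig (Site 2)) (fun δ => bondInterfaceIn D (E δ))
          (fun _ => bondPercolation (zdGraph 2) half) id (P D)) →
      P.IsLocal ∧ P.IsTargetIndependent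

/-- Alias of the statement of `stub_nonTracing` (no boundary-arc tracing for THE ℤ² interface limit family), keyed by the registered stub name. -/
abbrev stub_nonTracing : Prop :=
    CardyRotToConfDiscretisationsExist → CardyRotToConfR3ScaleInvariance →
    ∀ P : ChordalFamily,
      (∀ (D : DobrushinDomain) (E : ℝ → DiscreteDobrushin), IsDiscretisation D E →
        TendstoLaw (Ωδ := fun _ => BondConfig (Site 2)) (fun δ => bondInterfaceIn D (E δ))
          (fun _ => bondPercolation (zdGraph 2) half) id (P D)) →
      ∀ D : DobrushinDomain, ∀ᵐ γ ∂(P D), ∀ c : Curve ℂ, CurveClass.mk c = γ →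
        ∀ s t : unitInterval, s < t → c '' Set.Icc s t ⊆ frontier D.carrier →
          (c '' Set.Icc s t).Subsingleton

end Registered

/-! ### Canonicity, proved: the limit of r3 does not depend on the discretisation family -/

/-- Interleaving two families of discrete Dobrushin data along a set of meshes `S`. -/
def interleave (S : Set ℝ) (E₁ E₂ : ℝ → DiscreteDobrushin) : ℝ → DiscreteDobrushin :=
  fun δ => if δ ∈ S then E₁ δ else E₂ δ

theorem interleave_of_mem {S : Set ℝ} {E₁ E₂ : ℝ → DiscreteDobrushin} {δ : ℝ} (h : δ ∈ S) :
    interleave S E₁ E₂ δ = E₁ δ := by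
  simp [interleave, h]

theorem interleave_of_not_mem {S : Set ℝ} {E₁ E₂ : ℝ → DiscreteDobrushin} {δ : ℝ} (h : δ ∉ S) :
    interleave S E₁ E₂ δ = E₂ δ := by
  simp [interleave, h]

/-- Two discretisation families of the same Dobrushin domain, interleaved along any set of meshes,
form a discretisation family. -/
theorem isDiscretisation_interleave {D : DobrushinDomain} (S : Set ℝ)
    {E₁ E₂ : ℝ → DiscreteDobrushin} (h₁ : IsDiscretisation D E₁) (h₂ : IsDiscretisation D E₂) :
    IsDiscretisation D (interleave S E₁ E₂) where
  Ω_eq δ := by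
    by_cases hδ : δ ∈ S
    · rw [interleave_of_mem hδ]; exact h₁.Ω_eq δ
    · rw [interleave_of_not_mem hδ]; exact h₂.Ω_eq δ
  δ_eq δ := by
    by_cases hδ : δ ∈ S
    · rw [interleave_of_mem hδ]; exact h₁.δ_eq δ
    · rw [interleave_of_not_mem hδ]; exact h₂.δ_eq δ
  tendsto_arcA := by
    refine (h₁.tendsto_arcA.if' h₂.tendsto_arcA (p := fun δ => δ ∈ S)).congr fun δ => ?_
    by_cases hδ : δ ∈ S
    · simp only [if_pos hδ, interleave_of_mem hδ]
    · simp only [if_neg hδ, interleave_of_not_mem hδ]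
  tendsto_arcB := by
    refine (h₁.tendsto_arcB.if' h₂.tendsto_arcB (p := fun δ => δ ∈ S)).congr fun δ => ?_
    by_cases hδ : δ ∈ S
    · simp only [if_pos hδ, interleave_of_mem hδ]
    · simp only [if_neg hδ, interleave_of_not_mem hδ]
  tendsto_zdABEdges := by
    refine (h₁.tendsto_zdABEdges.if' h₂.tendsto_zdABEdges (p := fun δ => δ ∈ S)).congr
      fun δ => ?_
    by_cases hδ : δ ∈ S
    · simp only [if_pos hδ, interleave_of_mem hδ]
    · simp only [if_neg hδ, interleave_of_not_mem hδ]
  eventually_isZdAdmissible := by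
    filter_upwards [h₁.eventually_isZdAdmissible, h₂.eventually_isZdAdmissible] with δ hδ₁ hδ₂
    by_cases hδ : δ ∈ S
    · rw [interleave_of_mem hδ]; exact hδ₁
    · rw [interleave_of_not_mem hδ]; exact hδ₂

/-- The even reciprocal meshes `1/(2n+2)`. -/
def evenMeshes : Set ℝ := Set.range fun n : ℕ => (1 : ℝ) / (2 * n + 2)

/-- The even mesh sequence. -/
def evenSeq (n : ℕ) : ℝ := 1 / (2 * n + 2)

/-- The odd mesh sequence. -/
def oddSeq (n : ℕ) : ℝ := 1 / (2 * n + 3)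

theorem evenSeq_mem (n : ℕ) : evenSeq n ∈ evenMeshes := ⟨n, rfl⟩

theorem oddSeq_not_mem (n : ℕ) : oddSeq n ∉ evenMeshes := by
  rintro ⟨m, hm⟩
  simp only [oddSeq, one_div, inv_inj] at hm
  have h : (2 * m + 2 : ℕ) = 2 * n + 3 := by exact_mod_cast hm
  omega

theorem tendsto_evenSeq : Tendsto evenSeq atTop (𝓝[>] (0 : ℝ)) := by
  refine tendsto_nhdsWithin_iff.2 ⟨?_, Eventually.of_forall fun n => ?_⟩
  · refine tendsto_of_tendsto_of_tendsto_of_le_of_le tendsto_const_nhds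
      tendsto_one_div_add_atTop_nhds_zero_nat (fun n => ?_) (fun n => ?_)
    · simp only [evenSeq]; positivity
    · simp only [evenSeq]
      exact one_div_le_one_div_of_le (by positivity)
        (by linarith [(Nat.cast_nonneg n : (0 : ℝ) ≤ n)])
  · simp only [evenSeq, Set.mem_Ioi]; positivity

theorem tendsto_oddSeq : Tendsto oddSeq atTop (𝓝[>] (0 : ℝ)) := by
  refine tendsto_nhdsWithin_iff.2 ⟨?_, Eventually.of_forall fun n => ?_⟩
  · refine tendsto_of_tendsto_of_tendsto_of_le_of_le tendsto_const_nhds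
      tendsto_one_div_add_atTop_nhds_zero_nat (fun n => ?_) (fun n => ?_)
    · simp only [oddSeq]; positivity
    · simp only [oddSeq]
      exact one_div_le_one_div_of_le (by positivity)
        (by linarith [(Nat.cast_nonneg n : (0 : ℝ) ≤ n)])
  · simp only [oddSeq, Set.mem_Ioi]; positivity

/-- **Canonicity of the limit (proved).** Under (ii) discretisability and (iii) r3, there is ONE
family of laws `P` to which the interfaces of EVERY discretisation family of every Dobrushin domain
converge in law: the limit given by r3 for one family is the limit for all of them (interleaving). -/
theorem exists_interfaceLimit (hDisc : CardyRotToConfDiscretisationsExist)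
    (hR3 : CardyRotToConfR3ScaleInvariance) :
    ∃ P : ChordalFamily,
      ∀ (D : DobrushinDomain) (E : ℝ → DiscreteDobrushin), IsDiscretisation D E →
        TendstoLaw (Ωδ := fun _ => BondConfig (Site 2)) (fun δ => bondInterfaceIn D (E δ))
          (fun _ => bondPercolation (zdGraph 2) half) id (P D) := by
  have hDisc' : ∀ D : DobrushinDomain, ∃ E : ℝ → DiscreteDobrushin, IsDiscretisation D E := hDisc
  choose E₀ hE₀ using hDisc'
  have key : ∀ D : DobrushinDomain, ∃ ν : Measure (CurveClass ℂ),
      ∀ E : ℝ → DiscreteDobrushin, IsDiscretisation D E →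
        TendstoLaw (Ωδ := fun _ => BondConfig (Site 2)) (fun δ => bondInterfaceIn D (E δ))
          (fun _ => bondPercolation (zdGraph 2) half) id ν := by
    intro D
    obtain ⟨-, Z, hZ, hlim⟩ := hR3 D (E₀ D) (hE₀ D)
    refine ⟨Literature.Probability.Process.preWienerMeasure.map Z, fun E hE f => ?_⟩
    have hid : ∫ γ, f (id γ) ∂(Literature.Probability.Process.preWienerMeasure.map Z) =
        ∫ ω, f (Z ω) ∂Literature.Probability.Process.preWienerMeasure :=
      integral_map hZ f.continuous.aestronglyMeasurable
    rw [hid]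
    -- the interleaved family and its limit
    have hE'' : IsDiscretisation D (interleave evenMeshes (E₀ D) E) :=
      isDiscretisation_interleave evenMeshes (hE₀ D) hE
    obtain ⟨-, Z'', hZ'', hlim''⟩ := hR3 D _ hE''
    obtain ⟨-, Z', hZ', hlim'⟩ := hR3 D E hE
    -- along the even meshes the interleaved family is `E₀ D`
    have hL : ∫ ω, f (Z'' ω) ∂Literature.Probability.Process.preWienerMeasure =
        ∫ ω, f (Z ω) ∂Literature.Probability.Process.preWienerMeasure := by
      have h1 := (hlim'' f).comp tendsto_evenSeq
      have h2 := (hlim f).comp tendsto_evenSeq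
      refine tendsto_nhds_unique (h1.congr fun n => ?_) h2
      simp only [Function.comp_apply, interleave_of_mem (E₁ := E₀ D) (E₂ := E) (evenSeq_mem n)]
    -- along the odd meshes it is `E`
    have hL' : ∫ ω, f (Z'' ω) ∂Literature.Probability.Process.preWienerMeasure =
        ∫ ω, f (Z' ω) ∂Literature.Probability.Process.preWienerMeasure := by
      have h1 := (hlim'' f).comp tendsto_oddSeq
      have h2 := (hlim' f).comp tendsto_oddSeq
      refine tendsto_nhds_unique (h1.congr fun n => ?_) h2
      simp only [Function.comp_apply, interleave_of_not_mem (E₁ := E₀ D) (E₂ := E) (oddSeq_not_mem n)]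
    rw [← hL, hL']
    exact hlim' f
  choose ν hν using key
  exact ⟨ν, hν⟩

/-! ### The composition (sorry-free): the five stubs give the crux BY NAME -/

/-- **`CardyRotToConfLimitFamily` from the five stubs.** The canonical limit family `P` of
`exists_interfaceLimit` (canonicity, PROVED above from (ii) + (iii)) is chordal (S1), similarity
covariant (S2, consuming (i)), domain Markov (S3), local and target independent (S4) — i.e.
`IsLocalMarkovChordalFamily P` — and non-tracing (S5); the convergence clause is its definition.
Hypotheses keyed by the registered stub names (`Registered.stub_*` = the stub statements verbatim). -/
theorem CardyRotToConfLimitFamily_of (h₁ : Registered.stub_chordal)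
    (h₂ : Registered.stub_similarityCovariance) (h₃ : Registered.stub_domainMarkov)
    (h₄ : Registered.stub_locality) (h₅ : Registered.stub_nonTracing) :
    Summit.CriticalPhenomena.CardyFormulaZ2.Theses.CardyRotToConf.CardyRotToConfLimitFamily := by
  intro hRot hDisc hR3
  obtain ⟨P, hP⟩ := exists_interfaceLimit hDisc hR3
  obtain ⟨hloc, hti⟩ := h₄ hDisc hR3 P hP
  exact ⟨P, ⟨h₁ hDisc hR3 P hP, h₂ hRot hDisc hR3 P hP, h₃ hDisc hR3 P hP, hloc, hti⟩,
    h₅ hDisc hR3 P hP, hP⟩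

/-- Wiring check: the registered (sorried) stubs feed `CardyRotToConfLimitFamily_of` as stated. An
`example`, so that `CardyRotToConfLimitFamily_of` stays the only named theorem of this file concluding
the crux. -/
example : Summit.CriticalPhenomena.CardyFormulaZ2.Theses.CardyRotToConf.CardyRotToConfLimitFamily :=
  CardyRotToConfLimitFamily_of stub_chordal stub_similarityCovariance stub_domainMarkov stub_locality
    stub_nonTracing

end Summit.CriticalPhenomena.CardyFormulaZ2.Cruxes.CardyRotToConfLimitFamily.Birth
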